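import Literature.NumberTheory.Rogawski1990.ArchInnerTransferHaarForm          -- ★ A-p14 (g28): (14.2.1) in HAAR currency under (W′)(W)(C)(C′G) `finsum_integral_comp_conj_eq_finsum_integral_comp_conj_of_isArchInnerTransfer`
import Literature.NumberTheory.Rogawski1990.ArchInnerTransferRegularTorusIdentity -- ★ p842583 (R1-i-b): `corresponds_archDiagTorus`; brings ★ (T-d) FILE 2 (`isStablyConj_archCongr_iff`, `corresponds_archCongr_left/right_iff`, `isRegularElt_coe_archCongr_iff`)
import Literature.NumberTheory.Rogawski1990.ArchDeltaClassSumCongruence        -- ★ `integral_comp_conj_eq_of_isConj` (Haar-currency orbital integral is a class function); brings ★ (T-d) FILE 1 `integral_comp_conj_map_continuousMulEquiv`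
import Literature.NumberTheory.Rogawski1990.StableClassRegrouping             -- ★ `bijective_conjClassesMap_of_mulEquiv`
import Literature.NumberTheory.Automorphic.ArchStableOrbitalRegularState        -- ★ p841429 (R1-0): brings ★ (h1) `integral_comp_conj_archDiagTorus_map_symm_pi`, ★ `conjClasses_stable_archDiagTorus_eq_range`, fibre counts, properness ⇒ σ-finite orbit measures
import Literature.NumberTheory.Automorphic.UnitaryThreeAnisotropicStabilizerCompact -- ★ `compactSpace_centralizer_of_continuousMulEquiv`
import Literature.NumberTheory.Rogawski1990.ArchEndoscopicCurveRegularCompact   -- ★ `isCompact_centralizer_singleton_of_isConj`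
import Literature.NumberTheory.Automorphic.ArchLocalRelabelTransport            -- ★ `isMulRightInvariant_map_continuousMulEquiv`
import HarnessLib

/-!
# (14.2.1) ⇒ the orbit-currency regular identity `hreg` of ★ p842366 on the two diagonal carriers: the REGULAR HAAR-CURRENCY BRIDGE
# ((R1-i-d) of the (ST-∞) dress; Rogawski 1990 §1.7, §4.1 (4.1.1), §8.2 Prop. 8.2.1, §14.2 (14.2.1), §14.4)

Topic `NumberTheory/Rogawski1990`; namespace `Literature.NumberTheory.Rogawski1990` (generic §1 in `Literature.MeasureTheory.Group`, §2 in `Literature.NumberTheory.Automorphic.UnitaryGroup`).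
THEOREMS ONLY (no `def`, no instance, no notation, no axiom, no named fact, no `sorry`).  Cell `pub/hodgecm-mathlib`, ENGINE T1 (crux H413 = `stmt-HodgeConjecture-24833`); floor-2 road
«(J-nc) in-house», brick (R1-i-d) of R1 «(L-use) at all indefinite places» (LEAD-HANDOFF g9 §6 (4); census (R1-i-END) e599836f residual (E4a)); author F0P3a-p07 (g8), 2026-09-01.

WHY.  ★ p842366 `prod_mul_archStableOrbitalIntegral_kottwitzSign_eq_of_regular_eq_of_clause` (the R1 engine on the diagonal carriers `U(diag α′)`, `U(diag β)`) consumes the REGULAR identity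
`hreg` in ORBIT CURRENCY: for every regular `z`, `Σ_ρ K_{α′}⁻¹ ∫ Θ ↑↑(e⁻¹ o) d(⊗_v ν_v.map(y ↦ y·diag(z_v∘ρ_v)·y⁻¹)) = Σ_ρ K_β⁻¹ ∫ Θ′ ↑↑(e⁻¹ o) d(⊗_v ν′_v.map(…))`.  ★ p842470 (R1-i-a) derives it from
the Φ^st identity `hregΦ` for CANONICAL regular families (compact-core-one normalisation, ★ (R1-0)); but the closer pins the regular archimedean families in WEIL FORM `m′ = dν′ ∕ dt′`,
`m = dν ∕ dt` (`IsQuotientOf`, (W′)(W)) with ARBITRARY centralizer Haar data `t′, t` subject only to the compatibilities (C), (C′G) of the thirteen-conjunct system — and ★ A-p14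
`finsum_integral_comp_conj_eq_finsum_integral_comp_conj_of_isArchInnerTransfer` already turns (14.2.1) for such families into HAAR currency on `U(H′)(L ⊗ ℝ)` and `U(Φ₃)(L ⊗ ℝ)`:
`Σᶠ_{c′ : γ′ ∼st out c′} ∫ a′(g·out c′·g⁻¹) dν′ = Σᶠ_{c : γ ∼st out c} ∫ a(x·out c·x⁻¹) dν` (no `t′`, `t` left).  This file carries that identity along the (T-d) congruences
`Ψ : U(H′) ≃ₜ* U(diag α′)`, `Φ_A : U(Φ₃) ≃ₜ* U(diag β)` (`g ↦ S g S⁻¹`, `x ↦ T_A x T_A⁻¹`) to the diagonal carriers and rewrites each side as the K-weighted `ρ`-sum of ORBIT-MEASURE STATES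
— i.e. EXACTLY ★ p842366's `hreg`, for the product-Haar readings `Ψ_* ν′ = e⁻¹_*(⊗ ν_v)`, `(Φ_A)_* ν = e⁻¹_*(⊗ ν′_v)` and ambient lifts `a′ = Θ ∘ Ψ`, `a = Θ′ ∘ Φ_A` (★ FILE 4 + ★
`ArchSmooth.exists_contDiff` supply them).  No `IsCanonical` hypothesis is needed: the closer's Weil-form data are consumed VERBATIM.

WHAT IS PROVED.
* §1 (generic) `finsum_mem_conjClasses_map_eq_of_iff` — re-indexing a restricted class sum along a group isomorphism (`Σᶠ_{c ∈ S} F(e_* c) = Σᶠ_{d ∈ S′} F d` when `c ∈ S ↔ e_* c ∈ S′`).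
* §2 (diagonal carrier, any `N`): `finsum_mem_stable_archDiagTorus_eq_inv_mul_sum` — for ANY class function `F`, `Σᶠ_{c : t(z) ∼st out c} F c = K⁻¹ Σ_ρ F⟦t(z∘ρ)⟧` at a regular `z`
  (★ `conjClasses_stable_archDiagTorus_eq_range` + fibre count ★ `card_filter_mk_archDiagTorus_eq_prod_factorial`); `finsum_mem_stable_archDiagTorus_integral_comp_conj_eq_inv_mul_sum` — the
  Haar-currency class sum (the shape ★ A-p14 delivers) as `K⁻¹ Σ_ρ ∫ f(y·t(z∘ρ)·y⁻¹) dν` (★ `integral_comp_conj_eq_of_isConj` removes `out`);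
  `integral_comp_conj_archDiagTorus_map_symm_pi_eq_integral_pi_map_conj` — `∫ Θ ↑↑(g·t(z)·g⁻¹) d(e⁻¹_*(⊗ν_v)) = ∫ Θ ↑↑(e⁻¹ o) d(⊗_v ν_v.map conj_{diag z_v})` at regular `z` (★ (h1) + Mathlib
  `Measure.pi_map_pi`; σ-finiteness from properness ★); `finsum_mem_stable_integral_comp_conj_transport_archCongr` — the Haar-currency class sum is carried by a congruence `Ψ`.
* §3 **`sum_inv_mul_integral_pi_map_conj_eq_of_isArchInnerTransfer`** — THE BRIDGE: under ★ A-p14's hypotheses VERBATIM (`t′ t hd′ hd₃ hC hC′G ν′ ν m′ m hW′ hW a′ a ha′ ha hit`) plus the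
  congruences, the product-Haar readings and the ambient lifts, ★ p842366's `hreg` holds at every regular `z`.
HONEST LABEL: HC_CM is proved only modulo the 7 printed citations until rung 0 closes; this file is measure bookkeeping and pays nothing by itself.

## References
* [Rogawski1990] J. D. Rogawski, *Automorphic Representations of Unitary Groups in Three Variables*, Ann. of Math. Stud. 123 (1990), §1.7 p. 6, §4.1 (4.1.1) p. 39, §8.2 Prop. 8.2.1 p. 118, §14.2 (14.2.1) p. 232, §14.4 p. 237.
* [BorelJacquet1979] A. Borel, H. Jacquet, *Automorphic forms and automorphic representations*, PSPM 33.1 (1979), §4.1. [Folland1995] G. B. Folland, *A Course in Abstract Harmonic Analysis* (1995), §2.2 (2.28), §2.6 (2.52).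
* [DeitmarEchterhoff2014] A. Deitmar, S. Echterhoff, *Principles of Harmonic Analysis*, 2nd ed. (2014), Thm. 1.5.3.
-/

set_option autoImplicit false

noncomputable section

open MeasureTheory Measure NumberField NumberField.InfinitePlace NumberField.mixedEmbedding Equiv Function Set
open scoped Matrix MatrixGroups
/-! ## §1 Re-indexing a restricted class sum along a group isomorphism -/

namespace Literature.MeasureTheory.Group
/-- **`Σᶠ_{c ∈ S} F(e_* c) = Σᶠ_{d ∈ S′} F d`** whenever `c ∈ S ↔ e_* c ∈ S′`, for a group isomorphism `e` (`e_*` is a bijection on conjugacy classes, ★ `bijective_conjClassesMap_of_mulEquiv`;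
Mathlib `finsum_mem_eq_of_bijOn`). [cite: Rogawski1990, §14.4 p. 237] -/
theorem finsum_mem_conjClasses_map_eq_of_iff {G G' M : Type*} [Group G] [Group G'] [AddCommMonoid M] (e : G ≃* G')
    (S : Set (ConjClasses G)) (S' : Set (ConjClasses G')) (hS : ∀ c, c ∈ S ↔ ConjClasses.map e.toMonoidHom c ∈ S') (F : ConjClasses G' → M) :
    ∑ᶠ c ∈ S, F (ConjClasses.map e.toMonoidHom c) = ∑ᶠ d ∈ S', F d := by
  have hb := Literature.NumberTheory.Rogawski1990.bijective_conjClassesMap_of_mulEquiv e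
  refine finsum_mem_eq_of_bijOn (fun c => ConjClasses.map e.toMonoidHom c) ⟨fun c hc => (hS c).1 hc, hb.1.injOn, fun d hd => ?_⟩ (fun _ _ => rfl)
  obtain ⟨c, rfl⟩ := hb.2 d
  exact ⟨c, (hS c).2 hd, rfl⟩

end Literature.MeasureTheory.Group
/-! ## §2 The diagonal carrier: class sums over a regular stable class as `ρ`-sums, and the orbit-measure state -/

namespace Literature.NumberTheory.Automorphic.UnitaryGroup
open Literature.MeasureTheory.Group Literature.NumberTheory.Rogawski1990
section Diagonal
variable (L : Type) [Field L] [NumberField L] [IsCMField L] (N : ℕ) (α : Fin N → L)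

open scoped Classical in
/-- **`Σᶠ_{c : t(z) ∼st out c} F c = K⁻¹ · Σ_{ρ ∈ Π_w S_N} F⟦t(z∘ρ)⟧` for EVERY class function `F`** at a regular torus point (the stable class is the range of `ρ ↦ ⟦t(z∘ρ)⟧`, ★
`conjClasses_stable_archDiagTorus_eq_range`, each class hit `K = Π_w p_w!(N−p_w)!` times, ★ `card_filter_mk_archDiagTorus_eq_prod_factorial`). [cite: Rogawski1990, §4.1 (4.1.1) p. 39; §8.2 Prop. 8.2.1 p. 118] -/
theorem finsum_mem_stable_archDiagTorus_eq_inv_mul_sum (hα : ∀ i, α i ≠ 0) (hherm : ∀ i, (IsCMField.complexConj L (α i) : L) = α i)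
    {z : {w : InfinitePlace L // IsComplex w} → Fin N → Circle} (hz : ∀ w, Function.Injective (z w))
    (F : ConjClasses (arch (↥(maximalRealSubfield L)) L (IsCMField.complexConj L) N (Matrix.diagonal α)) → ℂ) :
    ∑ᶠ c ∈ {c : ConjClasses (arch (↥(maximalRealSubfield L)) L (IsCMField.complexConj L) N (Matrix.diagonal α)) |
        IsStablyConj (conjMixed (↥(maximalRealSubfield L)) L (IsCMField.complexConj L)) (archFormOf L N (Matrix.diagonal α)) (archDiagTorus L N α z) (Quotient.out c)}, F c =
      ((∏ w : {w : InfinitePlace L // IsComplex w},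
          (Finset.univ.filter fun i => 0 < (w.1.embedding (α i)).re).card.factorial *
            (N - (Finset.univ.filter fun i => 0 < (w.1.embedding (α i)).re).card).factorial : ℕ) : ℂ)⁻¹ *
        ∑ ρ : {w : InfinitePlace L // IsComplex w} → Perm (Fin N), F (ConjClasses.mk (archDiagTorus L N α fun w => z w ∘ ρ w)) := by
  have hsum := sum_eq_card_fiber_smul_sum_image
    (fun ρ : {w : InfinitePlace L // IsComplex w} → Perm (Fin N) => ConjClasses.mk (archDiagTorus L N α fun w => z w ∘ ρ w)) F _
    (card_filter_mk_archDiagTorus_eq_prod_factorial L N α hα hherm hz)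
  beta_reduce at hsum
  have hKpos : ((∏ w : {w : InfinitePlace L // IsComplex w},
      (Finset.univ.filter fun i => 0 < (w.1.embedding (α i)).re).card.factorial *
        (N - (Finset.univ.filter fun i => 0 < (w.1.embedding (α i)).re).card).factorial : ℕ) : ℂ) ≠ 0 := by
    rw [Nat.cast_ne_zero]
    exact (Finset.prod_pos fun w _ => Nat.mul_pos (Nat.factorial_pos _) (Nat.factorial_pos _)).ne'
  rw [hsum, nsmul_eq_mul, ← mul_assoc, inv_mul_cancel₀ hKpos, one_mul, finsum_mem_eq_finite_toFinset_sum _ (finite_conjClasses_stable_archDiagTorus L N α hα hherm hz)]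
  refine Finset.sum_congr ?_ fun _ _ => rfl
  apply Finset.coe_injective
  rw [Set.Finite.coe_toFinset, conjClasses_stable_archDiagTorus_eq_range L N α hα hherm hz, Finset.coe_image, Finset.coe_univ, Set.image_univ]

variable [MeasurableSpace (arch (↥(maximalRealSubfield L)) L (IsCMField.complexConj L) N (Matrix.diagonal α))]
  [BorelSpace (arch (↥(maximalRealSubfield L)) L (IsCMField.complexConj L) N (Matrix.diagonal α))]

open scoped Classical in
/-- **THE HAAR-CURRENCY CLASS SUM AS A `ρ`-SUM**: `Σᶠ_{c : t(z) ∼st out c} ∫ f(y·out c·y⁻¹) dν(y) = K⁻¹ · Σ_ρ ∫ f(y·t(z∘ρ)·y⁻¹) dν(y)` for a right-invariant `ν` (the previous lemma at the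
class function `c ↦ ∫ f(y·out c·y⁻¹) dν`, ★ `integral_comp_conj_eq_of_isConj` at `out⟦t(z∘ρ)⟧ ∼ t(z∘ρ)`). [cite: Rogawski1990, §4.1 (4.1.1) p. 39; §8.2 Prop. 8.2.1 p. 118] [cite: Folland1995, §2.2 (2.28)] -/
theorem finsum_mem_stable_archDiagTorus_integral_comp_conj_eq_inv_mul_sum (hα : ∀ i, α i ≠ 0) (hherm : ∀ i, (IsCMField.complexConj L (α i) : L) = α i)
    {z : {w : InfinitePlace L // IsComplex w} → Fin N → Circle} (hz : ∀ w, Function.Injective (z w))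
    (ν : Measure (arch (↥(maximalRealSubfield L)) L (IsCMField.complexConj L) N (Matrix.diagonal α))) [ν.IsMulRightInvariant]
    (f : arch (↥(maximalRealSubfield L)) L (IsCMField.complexConj L) N (Matrix.diagonal α) → ℂ) :
    ∑ᶠ c ∈ {c : ConjClasses (arch (↥(maximalRealSubfield L)) L (IsCMField.complexConj L) N (Matrix.diagonal α)) |
        IsStablyConj (conjMixed (↥(maximalRealSubfield L)) L (IsCMField.complexConj L)) (archFormOf L N (Matrix.diagonal α)) (archDiagTorus L N α z) (Quotient.out c)},
        ∫ y, f (y * Quotient.out c * y⁻¹) ∂ν =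
      ((∏ w : {w : InfinitePlace L // IsComplex w},
          (Finset.univ.filter fun i => 0 < (w.1.embedding (α i)).re).card.factorial *
            (N - (Finset.univ.filter fun i => 0 < (w.1.embedding (α i)).re).card).factorial : ℕ) : ℂ)⁻¹ *
        ∑ ρ : {w : InfinitePlace L // IsComplex w} → Perm (Fin N), ∫ y, f (y * archDiagTorus L N α (fun w => z w ∘ ρ w) * y⁻¹) ∂ν := by
  rw [finsum_mem_stable_archDiagTorus_eq_inv_mul_sum L N α hα hherm hz]
  congr 1
  refine Finset.sum_congr rfl fun ρ _ => ?_
  exact integral_comp_conj_eq_of_isConj ν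
    (ConjClasses.mk_eq_mk_iff_isConj.1 (Quotient.out_eq (ConjClasses.mk (archDiagTorus L N α fun w => z w ∘ ρ w))).symm) f

variable [∀ v : {w : InfinitePlace L // IsComplex w}, MeasurableSpace (archLocal L N (Matrix.diagonal α) v)]
  [∀ v : {w : InfinitePlace L // IsComplex w}, BorelSpace (archLocal L N (Matrix.diagonal α) v)]

open scoped Classical in
/-- **THE ORBIT-MEASURE STATE** at a regular torus point: `∫ Θ ↑↑(g·t(z)·g⁻¹) d(e⁻¹_*(⊗_v ν_v))(g) = ∫ Θ ↑↑(e⁻¹ o) d(⊗_v ν_v.map (y ↦ y·diag(z_v)·y⁻¹))(o)` (★ (h1)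
`integral_comp_conj_archDiagTorus_map_symm_pi`, Mathlib `Measure.pi_map_pi` — the regular orbit measures are σ-finite by properness ★ `isFiniteMeasureOnCompacts_map_conj_of_proper` — and
`integral_map`); the summand of ★ p842366's `hreg`. [cite: BorelJacquet1979, §4.1] [cite: Rogawski1990, §8.2 p. 118] [cite: Folland1995, §2.6 (2.52)] -/
theorem integral_comp_conj_archDiagTorus_map_symm_pi_eq_integral_pi_map_conj (hα : ∀ i, α i ≠ 0)
    (νw : ∀ v : {w : InfinitePlace L // IsComplex w}, Measure (archLocal L N (Matrix.diagonal α) v)) [∀ v, (νw v).IsHaarMeasure]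
    {z : {w : InfinitePlace L // IsComplex w} → Fin N → Circle} (hz : ∀ v, Function.Injective (z v))
    (Θ : Matrix (Fin N) (Fin N) (mixedSpace L) → ℂ) (hΘ : Continuous Θ) :
    ∫ g, Θ (((g * archDiagTorus L N α z * g⁻¹ : arch (↥(maximalRealSubfield L)) L (IsCMField.complexConj L) N (Matrix.diagonal α)) : GL (Fin N) (mixedSpace L)) : Matrix (Fin N) (Fin N) (mixedSpace L))
        ∂((Measure.pi νw).map (archPiEquivCM N L (Matrix.diagonal α)).symm) =
      ∫ o, Θ ((((archPiEquivCM N L (Matrix.diagonal α)).symm o : arch (↥(maximalRealSubfield L)) L (IsCMField.complexConj L) N (Matrix.diagonal α)) : GL (Fin N) (mixedSpace L)) : Matrix (Fin N) (Fin N) (mixedSpace L))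
        ∂(Measure.pi fun v : {w : InfinitePlace L // IsComplex w} => (νw v).map fun y : archLocal L N (Matrix.diagonal α) v =>
          y * (⟨circleDiagonal N (z v), circleDiagonal_mem_archLocal_diagonal L N α v (z v)⟩ : archLocal L N (Matrix.diagonal α) v) * y⁻¹) := by
  haveI : ∀ v : {w : InfinitePlace L // IsComplex w}, LocallyCompactSpace (archLocal L N (Matrix.diagonal α) v) := fun v => locallyCompactSpace_archLocal L N (Matrix.diagonal α) v
  haveI : ∀ v : {w : InfinitePlace L // IsComplex w}, SecondCountableTopology (archLocal L N (Matrix.diagonal α) v) := fun v => secondCountableTopology_archLocal L N (Matrix.diagonal α) v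
  have ha : Continuous fun g : arch (↥(maximalRealSubfield L)) L (IsCMField.complexConj L) N (Matrix.diagonal α) => Θ ((g : GL (Fin N) (mixedSpace L)) : Matrix (Fin N) (Fin N) (mixedSpace L)) :=
    hΘ.comp (Units.continuous_val.comp continuous_subtype_val)
  rw [integral_comp_conj_archDiagTorus_map_symm_pi L N α νw
    (fun g : arch (↥(maximalRealSubfield L)) L (IsCMField.complexConj L) N (Matrix.diagonal α) => Θ ((g : GL (Fin N) (mixedSpace L)) : Matrix (Fin N) (Fin N) (mixedSpace L))) z]
  haveI hfin : ∀ v : {w : InfinitePlace L // IsComplex w}, IsFiniteMeasureOnCompacts ((νw v).map fun y : archLocal L N (Matrix.diagonal α) v =>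
      y * (⟨circleDiagonal N (z v), circleDiagonal_mem_archLocal_diagonal L N α v (z v)⟩ : archLocal L N (Matrix.diagonal α) v) * y⁻¹) :=
    fun v => isFiniteMeasureOnCompacts_map_conj_of_proper L N α v (νw v) _ fun C hC =>
      isCompact_setOf_conj_circleDiagonal_mem_of_injective L N α v hα _ (hz v) C hC
  have hmeas : ∀ v : {w : InfinitePlace L // IsComplex w}, AEMeasurable (fun y : archLocal L N (Matrix.diagonal α) v =>
      y * (⟨circleDiagonal N (z v), circleDiagonal_mem_archLocal_diagonal L N α v (z v)⟩ : archLocal L N (Matrix.diagonal α) v) * y⁻¹) (νw v) :=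
    fun v => ((continuous_id.mul continuous_const).mul continuous_id.inv).measurable.aemeasurable
  rw [← Measure.pi_map_pi hmeas]
  have hφ : AEMeasurable (fun (y : ∀ v : {w : InfinitePlace L // IsComplex w}, archLocal L N (Matrix.diagonal α) v) (v : {w : InfinitePlace L // IsComplex w}) =>
      y v * (⟨circleDiagonal N (z v), circleDiagonal_mem_archLocal_diagonal L N α v (z v)⟩ : archLocal L N (Matrix.diagonal α) v) * (y v)⁻¹)
      (Measure.pi νw) :=
    (continuous_pi fun v => by
      have h1 : Continuous fun y : ∀ v : {w : InfinitePlace L // IsComplex w}, archLocal L N (Matrix.diagonal α) v => y v := continuous_apply v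
      exact (h1.mul continuous_const).mul h1.inv).measurable.aemeasurable
  have hF : Continuous fun o : ∀ v : {w : InfinitePlace L // IsComplex w}, archLocal L N (Matrix.diagonal α) v =>
      Θ ((((archPiEquivCM N L (Matrix.diagonal α)).symm o : arch (↥(maximalRealSubfield L)) L (IsCMField.complexConj L) N (Matrix.diagonal α)) : GL (Fin N) (mixedSpace L)) : Matrix (Fin N) (Fin N) (mixedSpace L)) :=
    ha.comp (archPiEquivCM N L (Matrix.diagonal α)).symm.continuous
  rw [integral_map hφ hF.aestronglyMeasurable]

end Diagonal
section Transport
variable (L : Type) [Field L] [NumberField L] [IsCMField L] {N : ℕ} {H H₂ : Matrix (Fin N) (Fin N) L} (T : GL (Fin N) (mixedSpace L))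
  (Φ : arch (↥(maximalRealSubfield L)) L (IsCMField.complexConj L) N H₂ ≃ₜ* arch (↥(maximalRealSubfield L)) L (IsCMField.complexConj L) N H)
  (hΦ : ∀ g : arch (↥(maximalRealSubfield L)) L (IsCMField.complexConj L) N H₂,
    ((Φ g : arch (↥(maximalRealSubfield L)) L (IsCMField.complexConj L) N H) : GL (Fin N) (mixedSpace L)) = T * (g : GL (Fin N) (mixedSpace L)) * T⁻¹)
  [MeasurableSpace (arch (↥(maximalRealSubfield L)) L (IsCMField.complexConj L) N H₂)] [BorelSpace (arch (↥(maximalRealSubfield L)) L (IsCMField.complexConj L) N H₂)]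
  [MeasurableSpace (arch (↥(maximalRealSubfield L)) L (IsCMField.complexConj L) N H)] [BorelSpace (arch (↥(maximalRealSubfield L)) L (IsCMField.complexConj L) N H)]

include hΦ in
/-- **THE HAAR-CURRENCY CLASS SUM IS CARRIED BY A CONGRUENCE**: for `Φ : U(H₂) ≃ₜ* U(H)`, `g ↦ T g T⁻¹`, a right-invariant `ν` on `U(H₂)(L ⊗ ℝ)`, an ambient `Θ` and `γ ∈ U(H₂)(L ⊗ ℝ)`,
`Σᶠ_{c : γ ∼st out c} ∫ Θ ↑↑(Φ(g·out c·g⁻¹)) dν(g) = Σᶠ_{d : γ₁ ∼st out d} ∫ Θ ↑↑(y·out d·y⁻¹) dμ(y)` for `Φ γ = γ₁`, `Φ_*ν = μ` (stated with the readings `γ₁`, `μ` as binders so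
that consumers substitute without rewriting under the class binder) — «`f_v = f′_v ∘ ψ_v⁻¹`» for the Haar-currency stable sum (★ FILE 1
`integral_comp_conj_map_continuousMulEquiv`, ★ `integral_comp_conj_eq_of_isConj` at `Φ(out c) ∼ out(Φ_* c)`, §1 with ★ FILE 2 `isStablyConj_archCongr_iff`).
[cite: Rogawski1990, §14.4 p. 237; §4.1 (4.1.1) p. 39] [cite: Folland1995, §2.6 (2.52)] -/
theorem finsum_mem_stable_integral_comp_conj_transport_archCongr
    (ν : Measure (arch (↥(maximalRealSubfield L)) L (IsCMField.complexConj L) N H₂)) [ν.IsMulRightInvariant]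
    {μ : Measure (arch (↥(maximalRealSubfield L)) L (IsCMField.complexConj L) N H)} (hμ : ν.map Φ = μ)
    (Θ : Matrix (Fin N) (Fin N) (mixedSpace L) → ℂ) (γ : arch (↥(maximalRealSubfield L)) L (IsCMField.complexConj L) N H₂)
    {γ₁ : arch (↥(maximalRealSubfield L)) L (IsCMField.complexConj L) N H} (hγ₁ : Φ γ = γ₁) :
    ∑ᶠ c ∈ {c : ConjClasses (arch (↥(maximalRealSubfield L)) L (IsCMField.complexConj L) N H₂) |
        IsStablyConj (conjMixed (↥(maximalRealSubfield L)) L (IsCMField.complexConj L)) (archFormOf L N H₂) γ (Quotient.out c)},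
        ∫ g, Θ (((Φ (g * Quotient.out c * g⁻¹) : arch (↥(maximalRealSubfield L)) L (IsCMField.complexConj L) N H) : GL (Fin N) (mixedSpace L)) : Matrix (Fin N) (Fin N) (mixedSpace L)) ∂ν =
      ∑ᶠ d ∈ {d : ConjClasses (arch (↥(maximalRealSubfield L)) L (IsCMField.complexConj L) N H) |
        IsStablyConj (conjMixed (↥(maximalRealSubfield L)) L (IsCMField.complexConj L)) (archFormOf L N H) γ₁ (Quotient.out d)},
        ∫ y, Θ (((y * Quotient.out d * y⁻¹ : arch (↥(maximalRealSubfield L)) L (IsCMField.complexConj L) N H) : GL (Fin N) (mixedSpace L)) : Matrix (Fin N) (Fin N) (mixedSpace L)) ∂μ := by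
  subst hμ hγ₁
  haveI : (ν.map Φ).IsMulRightInvariant := isMulRightInvariant_map_continuousMulEquiv Φ ν
  -- `Φ(out c) ∼ out (Φ_* c)` in `U(H)(L ⊗ ℝ)`
  have hoc : ∀ c : ConjClasses (arch (↥(maximalRealSubfield L)) L (IsCMField.complexConj L) N H₂),
      IsConj (Φ (Quotient.out c)) (Quotient.out (ConjClasses.map Φ.toMulEquiv.toMonoidHom c)) := fun c => by
    apply ConjClasses.mk_eq_mk_iff_isConj.1
    have e1 : ConjClasses.mk (Quotient.out (ConjClasses.map Φ.toMulEquiv.toMonoidHom c)) = ConjClasses.map Φ.toMulEquiv.toMonoidHom c := Quotient.out_eq _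
    have e2 : ConjClasses.mk (Quotient.out c) = c := Quotient.out_eq c
    have e3 : ConjClasses.mk (Φ (Quotient.out c)) = ConjClasses.map Φ.toMulEquiv.toMonoidHom (ConjClasses.mk (Quotient.out c)) := rfl
    rw [e1, e3, e2]
  have hF : ∀ c : ConjClasses (arch (↥(maximalRealSubfield L)) L (IsCMField.complexConj L) N H₂),
      ∫ g, Θ (((Φ (g * Quotient.out c * g⁻¹) : arch (↥(maximalRealSubfield L)) L (IsCMField.complexConj L) N H) : GL (Fin N) (mixedSpace L)) : Matrix (Fin N) (Fin N) (mixedSpace L)) ∂ν =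
        ∫ y, Θ (((y * Quotient.out (ConjClasses.map Φ.toMulEquiv.toMonoidHom c) * y⁻¹ : arch (↥(maximalRealSubfield L)) L (IsCMField.complexConj L) N H) : GL (Fin N) (mixedSpace L)) :
          Matrix (Fin N) (Fin N) (mixedSpace L)) ∂(ν.map Φ) := fun c => by
    rw [← integral_comp_conj_map_continuousMulEquiv Φ ν (fun x : arch (↥(maximalRealSubfield L)) L (IsCMField.complexConj L) N H =>
      Θ (((x : GL (Fin N) (mixedSpace L)) : Matrix (Fin N) (Fin N) (mixedSpace L)))) (Quotient.out c)]
    exact (integral_comp_conj_eq_of_isConj (ν.map Φ) (hoc c) (fun x : arch (↥(maximalRealSubfield L)) L (IsCMField.complexConj L) N H =>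
      Θ (((x : GL (Fin N) (mixedSpace L)) : Matrix (Fin N) (Fin N) (mixedSpace L))))).symm
  rw [finsum_mem_congr rfl fun c _ => hF c]
  refine finsum_mem_conjClasses_map_eq_of_iff Φ.toMulEquiv _ _ (fun c => ?_)
    (fun d => ∫ y, Θ (((y * Quotient.out d * y⁻¹ : arch (↥(maximalRealSubfield L)) L (IsCMField.complexConj L) N H) : GL (Fin N) (mixedSpace L)) : Matrix (Fin N) (Fin N) (mixedSpace L)) ∂(ν.map Φ))
  -- index sets correspond: `γ ∼st out c ↔ Φγ ∼st Φ(out c) ↔ Φγ ∼st out (Φ_* c)`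
  exact (isStablyConj_archCongr_iff L T Φ hΦ γ (Quotient.out c)).symm.trans
    ⟨fun h => h.trans (isStablyConj_of_isConj (hoc c)), fun h => h.trans (isStablyConj_of_isConj (hoc c)).symm⟩

end Transport

end Literature.NumberTheory.Automorphic.UnitaryGroup

/-! ## §3 THE BRIDGE: (14.2.1) for Weil-form regular families ⇒ ★ p842366's `hreg` on the diagonal carriers -/

namespace Literature.NumberTheory.Rogawski1990

open Literature.MeasureTheory.Group Literature.NumberTheory.Automorphic Literature.NumberTheory.Automorphic.UnitaryGroup

section Bridge

variable (L : Type) [Field L] [NumberField L] [IsCMField L] (H' : Matrix (Fin 3) (Fin 3) L)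
  [MeasurableSpace (UnitaryGroup.arch (↥(maximalRealSubfield L)) L (IsCMField.complexConj L) 3 H')]
  [BorelSpace (UnitaryGroup.arch (↥(maximalRealSubfield L)) L (IsCMField.complexConj L) 3 H')]
  [MeasurableSpace (UnitaryGroup.arch (↥(maximalRealSubfield L)) L (IsCMField.complexConj L) 3 (Matrix.of fun i j : Fin 3 => if i.val + j.val + 1 = 3 then (1 : L) else 0))]
  [BorelSpace (UnitaryGroup.arch (↥(maximalRealSubfield L)) L (IsCMField.complexConj L) 3 (Matrix.of fun i j : Fin 3 => if i.val + j.val + 1 = 3 then (1 : L) else 0))]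
  (t' : ∀ γ' : UnitaryGroup.arch (↥(maximalRealSubfield L)) L (IsCMField.complexConj L) 3 H',
    Measure (Subgroup.centralizer ({γ'} : Set (UnitaryGroup.arch (↥(maximalRealSubfield L)) L (IsCMField.complexConj L) 3 H'))))
  (t : ∀ γ : UnitaryGroup.arch (↥(maximalRealSubfield L)) L (IsCMField.complexConj L) 3 (Matrix.of fun i j : Fin 3 => if i.val + j.val + 1 = 3 then (1 : L) else 0),
    Measure (Subgroup.centralizer ({γ} : Set (UnitaryGroup.arch (↥(maximalRealSubfield L)) L (IsCMField.complexConj L) 3 (Matrix.of fun i j : Fin 3 => if i.val + j.val + 1 = 3 then (1 : L) else 0)))))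
  (hd' : H'.det ≠ 0) (hd₃ : (Matrix.of fun i j : Fin 3 => if i.val + j.val + 1 = 3 then (1 : L) else 0).det ≠ 0)
  -- (C): stable invariance of `t` on the quasi-split `G_∞` (conjunct 11 of ★ `ArchTransfersExistCanonical`'s system, its `det` proofs as the binder `hd₃`)
  (hC : ∀ (γ₁ γ₂ : UnitaryGroup.arch (↥(maximalRealSubfield L)) L (IsCMField.complexConj L) 3 (Matrix.of fun i j : Fin 3 => if i.val + j.val + 1 = 3 then (1 : L) else 0))
      (h₁ : IsRegularElt (γ₁.val : GL (Fin 3) (mixedEmbedding.mixedSpace L)))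
      (hc : Corresponds (UnitaryGroup.conjMixed (↥(maximalRealSubfield L)) L (IsCMField.complexConj L))
        (UnitaryGroup.archFormOf L 3 (Matrix.of fun i j : Fin 3 => if i.val + j.val + 1 = 3 then (1 : L) else 0))
        (UnitaryGroup.archFormOf L 3 (Matrix.of fun i j : Fin 3 => if i.val + j.val + 1 = 3 then (1 : L) else 0)) γ₁ γ₂),
      Measure.map ⇑(UnitaryGroup.archStableCentralizerEquiv L hd₃ hd₃ hc h₁) (t γ₁) = t γ₂)
  -- (C′G): `t′ ↔ t` across the inner twist (conjunct 12, `det` proofs as the binders `hd'`, `hd₃`)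
  (hC'G : ∀ (γ' : UnitaryGroup.arch (↥(maximalRealSubfield L)) L (IsCMField.complexConj L) 3 H')
      (γ : UnitaryGroup.arch (↥(maximalRealSubfield L)) L (IsCMField.complexConj L) 3 (Matrix.of fun i j : Fin 3 => if i.val + j.val + 1 = 3 then (1 : L) else 0))
      (h' : IsRegularElt (γ'.val : GL (Fin 3) (mixedEmbedding.mixedSpace L)))
      (hc : Corresponds (UnitaryGroup.conjMixed (↥(maximalRealSubfield L)) L (IsCMField.complexConj L))
        (UnitaryGroup.archFormOf L 3 H')
        (UnitaryGroup.archFormOf L 3 (Matrix.of fun i j : Fin 3 => if i.val + j.val + 1 = 3 then (1 : L) else 0)) γ' γ),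
      Measure.map ⇑(UnitaryGroup.archStableCentralizerEquiv L hd' hd₃ hc h') (t' γ') = t γ)
  [∀ γ' : UnitaryGroup.arch (↥(maximalRealSubfield L)) L (IsCMField.complexConj L) 3 H',
    MeasurableSpace (UnitaryGroup.arch (↥(maximalRealSubfield L)) L (IsCMField.complexConj L) 3 H' ⧸
      Subgroup.centralizer ({γ'} : Set (UnitaryGroup.arch (↥(maximalRealSubfield L)) L (IsCMField.complexConj L) 3 H')))]
  [∀ γ' : UnitaryGroup.arch (↥(maximalRealSubfield L)) L (IsCMField.complexConj L) 3 H',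
    BorelSpace (UnitaryGroup.arch (↥(maximalRealSubfield L)) L (IsCMField.complexConj L) 3 H' ⧸
      Subgroup.centralizer ({γ'} : Set (UnitaryGroup.arch (↥(maximalRealSubfield L)) L (IsCMField.complexConj L) 3 H')))]
  [∀ γ : UnitaryGroup.arch (↥(maximalRealSubfield L)) L (IsCMField.complexConj L) 3 (Matrix.of fun i j : Fin 3 => if i.val + j.val + 1 = 3 then (1 : L) else 0),
    MeasurableSpace (UnitaryGroup.arch (↥(maximalRealSubfield L)) L (IsCMField.complexConj L) 3 (Matrix.of fun i j : Fin 3 => if i.val + j.val + 1 = 3 then (1 : L) else 0) ⧸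
      Subgroup.centralizer ({γ} : Set (UnitaryGroup.arch (↥(maximalRealSubfield L)) L (IsCMField.complexConj L) 3 (Matrix.of fun i j : Fin 3 => if i.val + j.val + 1 = 3 then (1 : L) else 0))))]
  [∀ γ : UnitaryGroup.arch (↥(maximalRealSubfield L)) L (IsCMField.complexConj L) 3 (Matrix.of fun i j : Fin 3 => if i.val + j.val + 1 = 3 then (1 : L) else 0),
    BorelSpace (UnitaryGroup.arch (↥(maximalRealSubfield L)) L (IsCMField.complexConj L) 3 (Matrix.of fun i j : Fin 3 => if i.val + j.val + 1 = 3 then (1 : L) else 0) ⧸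
      Subgroup.centralizer ({γ} : Set (UnitaryGroup.arch (↥(maximalRealSubfield L)) L (IsCMField.complexConj L) 3 (Matrix.of fun i j : Fin 3 => if i.val + j.val + 1 = 3 then (1 : L) else 0))))]

include hC hC'G in
open scoped Classical in
/-- **(R1-i-d) THE REGULAR HAAR-CURRENCY BRIDGE.**  In a frame `(L, H′)` with the closer's archimedean data VERBATIM — Haar measures `ν′` on `G′_∞ = U(H′)(L ⊗ ℝ)`, `ν` on
`G_∞ = U(Φ₃)(L ⊗ ℝ)`, Weil-form REGULAR families `m′ = dν′ ∕ dt′`, `m = dν ∕ dt` ((W′), (W): ★ `IsQuotientOf`, ANY centralizer Haar data `t′`, `t`) with the compatibilities (C), (C′G),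
and a measurable (14.2.1)-pair `a′, a` (`IsArchInnerTransfer L H′ m′ m a′ a`) — let `Ψ : U(H′) ≃ₜ* U(diag α′)`, `Φ_A : U(Φ₃) ≃ₜ* U(diag β)` be congruences `g ↦ S g S⁻¹`, `x ↦ T_A x T_A⁻¹`
onto DIAGONAL carriers (`α′`, `β` real, non-zero), read the transported Haar measures as products `Ψ_* ν′ = e⁻¹_*(⊗_v ν_v)`, `(Φ_A)_* ν = e⁻¹_*(⊗_v ν′_v)` and the functions through
ambient `Θ`, `Θ′` (`a′ = Θ ∘ ↑↑ ∘ Ψ`, `a = Θ′ ∘ ↑↑ ∘ Φ_A`).  THEN ★ p842366's `hreg` HOLDS at every regular `z`: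
`Σ_ρ K_{α′}⁻¹ · ∫ Θ ↑↑(e⁻¹ o) d(⊗_v ν_v.map (y ↦ y·diag(z_v∘ρ_v)·y⁻¹)) = Σ_ρ K_β⁻¹ · ∫ Θ′ ↑↑(e⁻¹ o) d(⊗_v ν′_v.map (y ↦ y·diag(z_v∘ρ_v)·y⁻¹))`, `K = Π_v p_v!(3−p_v)!`.
Proof: ★ A-p14 at the matched regular pair `γ′ = Ψ⁻¹ t_{α′}(z) ↔ γ = Φ_A⁻¹ t_β(z)` (both `GL₃(L ⊗ ℝ)`-conjugate to the common matrix `t(z)`, ★ `corresponds_archDiagTorus`; compact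
centralisers across both stable classes from ★ `isCompact_centralizer_archDiagTorus` pulled back along the congruences), then §2 on each side.  No `IsCanonical` hypothesis.
[cite: Rogawski1990, §1.7 p. 6; §4.1 (4.1.1) p. 39; §8.2 Prop. 8.2.1 p. 118; §14.2 (14.2.1) p. 232; §14.4 p. 237] [cite: BorelJacquet1979, §4.1] [cite: Folland1995, §2.6 (2.52)]
[cite: DeitmarEchterhoff2014, Thm. 1.5.3] -/
theorem sum_inv_mul_integral_pi_map_conj_eq_of_isArchInnerTransfer
    (ν' : Measure (UnitaryGroup.arch (↥(maximalRealSubfield L)) L (IsCMField.complexConj L) 3 H'))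
    (ν : Measure (UnitaryGroup.arch (↥(maximalRealSubfield L)) L (IsCMField.complexConj L) 3 (Matrix.of fun i j : Fin 3 => if i.val + j.val + 1 = 3 then (1 : L) else 0)))
    [ν'.IsHaarMeasure] [ν'.IsMulRightInvariant] [ν.IsHaarMeasure] [ν.IsMulRightInvariant]
    (m' : OrbitalMeasureFamily (UnitaryGroup.arch (↥(maximalRealSubfield L)) L (IsCMField.complexConj L) 3 H'))
    (m : OrbitalMeasureFamily (UnitaryGroup.arch (↥(maximalRealSubfield L)) L (IsCMField.complexConj L) 3 (Matrix.of fun i j : Fin 3 => if i.val + j.val + 1 = 3 then (1 : L) else 0)))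
    (hW' : m'.IsQuotientOf (fun γ => IsRegularElt (γ.val : GL (Fin 3) (mixedEmbedding.mixedSpace L))) ν' t')
    (hW : m.IsQuotientOf (fun γ => IsRegularElt (γ.val : GL (Fin 3) (mixedEmbedding.mixedSpace L))) ν t)
    (a' : UnitaryGroup.arch (↥(maximalRealSubfield L)) L (IsCMField.complexConj L) 3 H' → ℂ)
    (a : UnitaryGroup.arch (↥(maximalRealSubfield L)) L (IsCMField.complexConj L) 3 (Matrix.of fun i j : Fin 3 => if i.val + j.val + 1 = 3 then (1 : L) else 0) → ℂ)
    (ha' : Measurable a') (ha : Measurable a) (hit : IsArchInnerTransfer L H' m' m a' a)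
    -- the (T-d) congruences onto the diagonal carriers
    (α' β : Fin 3 → L) (hα' : ∀ i, α' i ≠ 0) (hhermα : ∀ i, (IsCMField.complexConj L (α' i) : L) = α' i) (hβ : ∀ i, β i ≠ 0) (hhermβ : ∀ i, (IsCMField.complexConj L (β i) : L) = β i)
    [MeasurableSpace (UnitaryGroup.arch (↥(maximalRealSubfield L)) L (IsCMField.complexConj L) 3 (Matrix.diagonal α'))]
    [BorelSpace (UnitaryGroup.arch (↥(maximalRealSubfield L)) L (IsCMField.complexConj L) 3 (Matrix.diagonal α'))]
    [MeasurableSpace (UnitaryGroup.arch (↥(maximalRealSubfield L)) L (IsCMField.complexConj L) 3 (Matrix.diagonal β))]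
    [BorelSpace (UnitaryGroup.arch (↥(maximalRealSubfield L)) L (IsCMField.complexConj L) 3 (Matrix.diagonal β))]
    [∀ v : {w : InfinitePlace L // IsComplex w}, MeasurableSpace (archLocal L 3 (Matrix.diagonal α') v)] [∀ v : {w : InfinitePlace L // IsComplex w}, BorelSpace (archLocal L 3 (Matrix.diagonal α') v)]
    [∀ v : {w : InfinitePlace L // IsComplex w}, MeasurableSpace (archLocal L 3 (Matrix.diagonal β) v)] [∀ v : {w : InfinitePlace L // IsComplex w}, BorelSpace (archLocal L 3 (Matrix.diagonal β) v)]
    (S : GL (Fin 3) (mixedSpace L))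
    (Ψ : UnitaryGroup.arch (↥(maximalRealSubfield L)) L (IsCMField.complexConj L) 3 H' ≃ₜ* UnitaryGroup.arch (↥(maximalRealSubfield L)) L (IsCMField.complexConj L) 3 (Matrix.diagonal α'))
    (hΨ : ∀ g, ((Ψ g : UnitaryGroup.arch (↥(maximalRealSubfield L)) L (IsCMField.complexConj L) 3 (Matrix.diagonal α')) : GL (Fin 3) (mixedSpace L)) = S * (g : GL (Fin 3) (mixedSpace L)) * S⁻¹)
    (T_A : GL (Fin 3) (mixedSpace L))
    (Φ_A : UnitaryGroup.arch (↥(maximalRealSubfield L)) L (IsCMField.complexConj L) 3 (Matrix.of fun i j : Fin 3 => if i.val + j.val + 1 = 3 then (1 : L) else 0) ≃ₜ* UnitaryGroup.arch (↥(maximalRealSubfield L)) L (IsCMField.complexConj L) 3 (Matrix.diagonal β))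
    (hΦ_A : ∀ g, ((Φ_A g : UnitaryGroup.arch (↥(maximalRealSubfield L)) L (IsCMField.complexConj L) 3 (Matrix.diagonal β)) : GL (Fin 3) (mixedSpace L)) = T_A * (g : GL (Fin 3) (mixedSpace L)) * T_A⁻¹)
    -- the product-Haar readings of the transported measures
    (νw : ∀ v : {w : InfinitePlace L // IsComplex w}, Measure (archLocal L 3 (Matrix.diagonal α') v)) (hνw : ∀ v, (νw v).IsHaarMeasure)
    (hν' : ν'.map Ψ = (Measure.pi νw).map (archPiEquivCM 3 L (Matrix.diagonal α')).symm)
    (νw' : ∀ v : {w : InfinitePlace L // IsComplex w}, Measure (archLocal L 3 (Matrix.diagonal β) v)) (hνw' : ∀ v, (νw' v).IsHaarMeasure)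
    (hν : ν.map Φ_A = (Measure.pi νw').map (archPiEquivCM 3 L (Matrix.diagonal β)).symm)
    -- the ambient lifts of the transported functions
    (Θ Θ' : Matrix (Fin 3) (Fin 3) (mixedSpace L) → ℂ) (hΘ : Continuous Θ) (hΘ' : Continuous Θ')
    (haΘ : ∀ x, a' x = Θ (((Ψ x : UnitaryGroup.arch (↥(maximalRealSubfield L)) L (IsCMField.complexConj L) 3 (Matrix.diagonal α')) : GL (Fin 3) (mixedSpace L)) : Matrix (Fin 3) (Fin 3) (mixedSpace L)))
    (haΘ' : ∀ x, a x = Θ' (((Φ_A x : UnitaryGroup.arch (↥(maximalRealSubfield L)) L (IsCMField.complexConj L) 3 (Matrix.diagonal β)) : GL (Fin 3) (mixedSpace L)) : Matrix (Fin 3) (Fin 3) (mixedSpace L)))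
    (z : {w : InfinitePlace L // IsComplex w} → Fin 3 → Circle) (hz : ∀ v, Function.Injective (z v)) :
    ∑ ρ : {w : InfinitePlace L // IsComplex w} → Perm (Fin 3), ((∏ v : {w : InfinitePlace L // IsComplex w},
          (Finset.univ.filter fun i => 0 < (v.1.embedding (α' i)).re).card.factorial *
            (3 - (Finset.univ.filter fun i => 0 < (v.1.embedding (α' i)).re).card).factorial : ℕ) : ℂ)⁻¹ *
        ∫ o, Θ ((((archPiEquivCM 3 L (Matrix.diagonal α')).symm o : UnitaryGroup.arch (↥(maximalRealSubfield L)) L (IsCMField.complexConj L) 3 (Matrix.diagonal α')) : GL (Fin 3) (mixedSpace L)) : Matrix (Fin 3) (Fin 3) (mixedSpace L))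
          ∂(Measure.pi fun v : {w : InfinitePlace L // IsComplex w} => (νw v).map fun y : archLocal L 3 (Matrix.diagonal α') v =>
            y * (⟨circleDiagonal 3 (z v ∘ ⇑(ρ v)), circleDiagonal_mem_archLocal_diagonal L 3 α' v (z v ∘ ⇑(ρ v))⟩ : archLocal L 3 (Matrix.diagonal α') v) * y⁻¹) =
      ∑ ρ : {w : InfinitePlace L // IsComplex w} → Perm (Fin 3), ((∏ v : {w : InfinitePlace L // IsComplex w},
          (Finset.univ.filter fun i => 0 < (v.1.embedding (β i)).re).card.factorial *
            (3 - (Finset.univ.filter fun i => 0 < (v.1.embedding (β i)).re).card).factorial : ℕ) : ℂ)⁻¹ *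
        ∫ o, Θ' ((((archPiEquivCM 3 L (Matrix.diagonal β)).symm o : UnitaryGroup.arch (↥(maximalRealSubfield L)) L (IsCMField.complexConj L) 3 (Matrix.diagonal β)) : GL (Fin 3) (mixedSpace L)) : Matrix (Fin 3) (Fin 3) (mixedSpace L))
          ∂(Measure.pi fun v : {w : InfinitePlace L // IsComplex w} => (νw' v).map fun y : archLocal L 3 (Matrix.diagonal β) v =>
            y * (⟨circleDiagonal 3 (z v ∘ ⇑(ρ v)), circleDiagonal_mem_archLocal_diagonal L 3 β v (z v ∘ ⇑(ρ v))⟩ : archLocal L 3 (Matrix.diagonal β) v) * y⁻¹) := by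
  obtain ⟨γ, hΦγ⟩ : ∃ γ, Φ_A γ = archDiagTorus L 3 β z := ⟨Φ_A.symm _, Φ_A.apply_symm_apply _⟩
  obtain ⟨γ', hΨγ'⟩ : ∃ γ', Ψ γ' = archDiagTorus L 3 α' z := ⟨Ψ.symm _, Ψ.apply_symm_apply _⟩
  have hreg : IsRegularElt (γ.val : GL (Fin 3) (mixedEmbedding.mixedSpace L)) := by
    rw [← isRegularElt_coe_archCongr_iff L T_A Φ_A hΦ_A γ, hΦγ]
    exact (isRegularElt_archDiagTorus_iff L 3 β z).2 hz
  have hcorr : Corresponds (UnitaryGroup.conjMixed (↥(maximalRealSubfield L)) L (IsCMField.complexConj L)) (UnitaryGroup.archFormOf L 3 H')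
      (UnitaryGroup.archFormOf L 3 (Matrix.of fun i j : Fin 3 => if i.val + j.val + 1 = 3 then (1 : L) else 0)) γ' γ := by
    rw [← corresponds_archCongr_left_iff L S Ψ hΨ γ' γ, hΨγ', ← corresponds_archCongr_right_iff L T_A Φ_A hΦ_A (archDiagTorus L 3 α' z) γ, hΦγ]
    exact corresponds_archDiagTorus L 3 α' β z
  have hZ : ∀ δ, IsStablyConj (UnitaryGroup.conjMixed (↥(maximalRealSubfield L)) L (IsCMField.complexConj L)) (UnitaryGroup.archFormOf L 3 (Matrix.of fun i j : Fin 3 => if i.val + j.val + 1 = 3 then (1 : L) else 0)) γ δ →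
      CompactSpace (Subgroup.centralizer ({δ} : Set (UnitaryGroup.arch (↥(maximalRealSubfield L)) L (IsCMField.complexConj L) 3 (Matrix.of fun i j : Fin 3 => if i.val + j.val + 1 = 3 then (1 : L) else 0)))) := by
    intro δ hδ
    have h1 := (isStablyConj_archCongr_iff L T_A Φ_A hΦ_A γ δ).2 hδ
    rw [hΦγ] at h1
    obtain ⟨ρ, hρ⟩ := exists_isConj_archDiagTorus_of_isStablyConj L 3 β hβ hhermβ hz (Φ_A δ) h1
    haveI : CompactSpace (Subgroup.centralizer ({Φ_A δ} : Set (UnitaryGroup.arch (↥(maximalRealSubfield L)) L (IsCMField.complexConj L) 3 (Matrix.diagonal β)))) :=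
      isCompact_iff_compactSpace.1 (isCompact_centralizer_singleton_of_isConj hρ
        (isCompact_centralizer_archDiagTorus L 3 β hβ fun w => (hz w).comp (ρ w).injective))
    exact compactSpace_centralizer_of_continuousMulEquiv Φ_A δ
  have hZ' : ∀ δ', IsStablyConj (UnitaryGroup.conjMixed (↥(maximalRealSubfield L)) L (IsCMField.complexConj L)) (UnitaryGroup.archFormOf L 3 H') γ' δ' →
      CompactSpace (Subgroup.centralizer ({δ'} : Set (UnitaryGroup.arch (↥(maximalRealSubfield L)) L (IsCMField.complexConj L) 3 H'))) := by
    intro δ' hδ'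
    have h1 := (isStablyConj_archCongr_iff L S Ψ hΨ γ' δ').2 hδ'
    rw [hΨγ'] at h1
    obtain ⟨ρ, hρ⟩ := exists_isConj_archDiagTorus_of_isStablyConj L 3 α' hα' hhermα hz (Ψ δ') h1
    haveI : CompactSpace (Subgroup.centralizer ({Ψ δ'} : Set (UnitaryGroup.arch (↥(maximalRealSubfield L)) L (IsCMField.complexConj L) 3 (Matrix.diagonal α')))) :=
      isCompact_iff_compactSpace.1 (isCompact_centralizer_singleton_of_isConj hρ
        (isCompact_centralizer_archDiagTorus L 3 α' hα' fun w => (hz w).comp (ρ w).injective))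
    exact compactSpace_centralizer_of_continuousMulEquiv Ψ δ'
  have key := finsum_integral_comp_conj_eq_finsum_integral_comp_conj_of_isArchInnerTransfer L H' t' t hd' hd₃ hC hC'G ν' ν m' m hW' hW a' a ha' ha hit γ hreg γ' hcorr hZ hZ'
  have ha'Θ : a' = fun x => Θ (((Ψ x : UnitaryGroup.arch (↥(maximalRealSubfield L)) L (IsCMField.complexConj L) 3 (Matrix.diagonal α')) : GL (Fin 3) (mixedSpace L)) : Matrix (Fin 3) (Fin 3) (mixedSpace L)) :=
    funext haΘ
  have haΘ2 : a = fun x => Θ' (((Φ_A x : UnitaryGroup.arch (↥(maximalRealSubfield L)) L (IsCMField.complexConj L) 3 (Matrix.diagonal β)) : GL (Fin 3) (mixedSpace L)) : Matrix (Fin 3) (Fin 3) (mixedSpace L)) :=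
    funext haΘ'
  rw [ha'Θ, haΘ2] at key
  beta_reduce at key
  rw [finsum_mem_stable_integral_comp_conj_transport_archCongr L S Ψ hΨ ν' hν' Θ γ' hΨγ',
    finsum_mem_stable_integral_comp_conj_transport_archCongr L T_A Φ_A hΦ_A ν hν Θ' γ hΦγ] at key
  haveI hr1 : ((Measure.pi νw).map (archPiEquivCM 3 L (Matrix.diagonal α')).symm).IsMulRightInvariant := hν' ▸ isMulRightInvariant_map_continuousMulEquiv Ψ ν'
  haveI hn1 : ∀ v : {w : InfinitePlace L // IsComplex w}, (νw v).IsHaarMeasure := hνw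
  have hDα := finsum_mem_stable_archDiagTorus_integral_comp_conj_eq_inv_mul_sum L 3 α' hα' hhermα hz ((Measure.pi νw).map (archPiEquivCM 3 L (Matrix.diagonal α')).symm)
    (fun y : UnitaryGroup.arch (↥(maximalRealSubfield L)) L (IsCMField.complexConj L) 3 (Matrix.diagonal α') => Θ (((y : GL (Fin 3) (mixedSpace L)) : Matrix (Fin 3) (Fin 3) (mixedSpace L))))
  beta_reduce at hDα
  have hSα : ∑ ρ : {w : InfinitePlace L // IsComplex w} → Perm (Fin 3),
      ∫ y, Θ (((y * archDiagTorus L 3 α' (fun w => z w ∘ ρ w) * y⁻¹ : UnitaryGroup.arch (↥(maximalRealSubfield L)) L (IsCMField.complexConj L) 3 (Matrix.diagonal α')) : GL (Fin 3) (mixedSpace L)) : Matrix (Fin 3) (Fin 3) (mixedSpace L))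
        ∂((Measure.pi νw).map (archPiEquivCM 3 L (Matrix.diagonal α')).symm) =
      ∑ ρ : {w : InfinitePlace L // IsComplex w} → Perm (Fin 3),
        ∫ o, Θ ((((archPiEquivCM 3 L (Matrix.diagonal α')).symm o : UnitaryGroup.arch (↥(maximalRealSubfield L)) L (IsCMField.complexConj L) 3 (Matrix.diagonal α')) : GL (Fin 3) (mixedSpace L)) : Matrix (Fin 3) (Fin 3) (mixedSpace L))
          ∂(Measure.pi fun v : {w : InfinitePlace L // IsComplex w} => (νw v).map fun y : archLocal L 3 (Matrix.diagonal α') v =>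
            y * (⟨circleDiagonal 3 (z v ∘ ⇑(ρ v)), circleDiagonal_mem_archLocal_diagonal L 3 α' v (z v ∘ ⇑(ρ v))⟩ : archLocal L 3 (Matrix.diagonal α') v) * y⁻¹) :=
    Finset.sum_congr rfl fun ρ _ =>
      integral_comp_conj_archDiagTorus_map_symm_pi_eq_integral_pi_map_conj L 3 α' hα' νw (fun v => (hz v).comp (ρ v).injective) Θ hΘ
  rw [hDα, hSα] at key
  clear hDα hSα hr1 hn1
  haveI hr2 : ((Measure.pi νw').map (archPiEquivCM 3 L (Matrix.diagonal β)).symm).IsMulRightInvariant := hν ▸ isMulRightInvariant_map_continuousMulEquiv Φ_A ν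
  haveI hn2 : ∀ v : {w : InfinitePlace L // IsComplex w}, (νw' v).IsHaarMeasure := hνw'
  have hDβ := finsum_mem_stable_archDiagTorus_integral_comp_conj_eq_inv_mul_sum L 3 β hβ hhermβ hz ((Measure.pi νw').map (archPiEquivCM 3 L (Matrix.diagonal β)).symm)
    (fun y : UnitaryGroup.arch (↥(maximalRealSubfield L)) L (IsCMField.complexConj L) 3 (Matrix.diagonal β) => Θ' (((y : GL (Fin 3) (mixedSpace L)) : Matrix (Fin 3) (Fin 3) (mixedSpace L))))
  beta_reduce at hDβ
  have hSβ : ∑ ρ : {w : InfinitePlace L // IsComplex w} → Perm (Fin 3),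
      ∫ y, Θ' (((y * archDiagTorus L 3 β (fun w => z w ∘ ρ w) * y⁻¹ : UnitaryGroup.arch (↥(maximalRealSubfield L)) L (IsCMField.complexConj L) 3 (Matrix.diagonal β)) : GL (Fin 3) (mixedSpace L)) : Matrix (Fin 3) (Fin 3) (mixedSpace L))
        ∂((Measure.pi νw').map (archPiEquivCM 3 L (Matrix.diagonal β)).symm) =
      ∑ ρ : {w : InfinitePlace L // IsComplex w} → Perm (Fin 3),
        ∫ o, Θ' ((((archPiEquivCM 3 L (Matrix.diagonal β)).symm o : UnitaryGroup.arch (↥(maximalRealSubfield L)) L (IsCMField.complexConj L) 3 (Matrix.diagonal β)) : GL (Fin 3) (mixedSpace L)) : Matrix (Fin 3) (Fin 3) (mixedSpace L))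
          ∂(Measure.pi fun v : {w : InfinitePlace L // IsComplex w} => (νw' v).map fun y : archLocal L 3 (Matrix.diagonal β) v =>
            y * (⟨circleDiagonal 3 (z v ∘ ⇑(ρ v)), circleDiagonal_mem_archLocal_diagonal L 3 β v (z v ∘ ⇑(ρ v))⟩ : archLocal L 3 (Matrix.diagonal β) v) * y⁻¹) :=
    Finset.sum_congr rfl fun ρ _ =>
      integral_comp_conj_archDiagTorus_map_symm_pi_eq_integral_pi_map_conj L 3 β hβ νw' (fun v => (hz v).comp (ρ v).injective) Θ' hΘ'
  rw [hDβ, hSβ, Finset.mul_sum, Finset.mul_sum] at key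
  exact key

end Bridge

end Literature.NumberTheory.Rogawski1990

end
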